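import Summits.Ventures.HSemireg.WedgeHankelClassSpaceIrreducible
import Summits.Ventures.HSemireg.WedgeHankelSubstitutionParabolicCharP
import Summits.Ventures.HSemireg.WedgeHankelSubstitutionSingularSpectrum

/-!
# Venture HSemireg — IRREDUCIBILITY OF TH-7's CLASS SPACE UNDER THE TWO UNIPOTENT SUBSTITUTIONS (`n! ≠ 0`): a non-zero subspace stable under the upper shear `SbC(1 1 0 1)`
# and the LOWER shear `SbC(1 0 1 1)` is everything — the lower Jordan chain `(SbC(1 0 1 1) − 1)^n E_n = n!·E_0` replaces the swap of J9 — and the corollary for the full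
# group: a subspace stable under every substitution is `⊥` or `⊤`

HONEST FRAMING. Part of the Lean index of the computation cell `pub-hsemireg` (seat p10 gen 20, Sunday typer «UNIFORM-IN-n»).
Finite-dimensional EXTERIOR ALGEBRA + linear algebra ONLY: no variety, no cohomology theory, no sheaf, no Ext group, no semiregularity map;
nothing here says that HC / HC_CM / HC_AV holds; no Literature fact is declared or used.  Custodian versions as in `WedgeHankelSiegelIdeal` (1/3) and `WedgeHankelFrameChange`;
the dictionary (`Sym^n` is irreducible under the subgroup generated by the two elementary unipotents of `SL₂` in characteristic `0` / `p > n`) is QUOTED, never asserted.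

WHAT IS IN THE TREE.  J9 (`WedgeHankelClassSpaceIrreducible`): `spike_top_mem_of_stable` (a shear-stable `W ≠ ⊥` contains `E_n` when `n! ≠ 0`), `spike_mem_of_stable` (with `E_0 ∈ W`,
every `E_k ∈ W`), `eq_top_of_shear_swap_stable`, `pow_apply_mem_of_forall_mem`, `Sb_swap_w_spike_top`; J11 (`WedgeHankelSubstitutionParabolicCharP`): `SbC_lower_shear_eq_swap_conj`,
`SbC_swap_mul_swap`, `pow_eq_conj_of_mul_eq`; J1 `Sb_w_spike_zero`; I18 `SbC_shear_sub_one_pow_self_apply_spike_zero`.  THIS FILE (namespace `Summit.Ventures.HSemireg.Wedge.HankelFrameChange`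
continued; imports J9, J11, J1):
* §250 `Sb_swap_w_spike_zero` / `SbC_swap_spike_zero` (`Sb(0 1 1 0) E_0 = E_n`), `SbC_lower_shear_sub_one_mul_swap` (`(L − 1)·S = S·(U − 1)`),
  **`SbC_lower_shear_sub_one_pow_self_apply_spike_top`: `(SbC(1 0 1 1) − 1)^n E_n = n!·E_0`** (the LOWER Jordan chain ends in the pure class).
* §251 **`spike_zero_mem_of_unipotent_stable`** (`n! ≠ 0`: a non-zero subspace stable under both shears contains `E_0`), `eq_top_of_shear_stable_of_spike_zero_mem`,
  **`eq_top_of_unipotent_stable`: every non-zero subspace of `spikeSpan n` stable under `SbC(1 1 0 1)` and `SbC(1 0 1 1)` is `⊤`** (`n! ≠ 0`).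
* §252 the full monoid: **`eq_bot_or_eq_top_of_forall_SbC_stable`** (a subspace stable under every `SbC(g)` is trivial; `n! ≠ 0`), `eq_bot_or_eq_top_of_unipotent_stable`.
NOT typed here: characteristic `p ≤ n` (J8: reducible for `n = p^e`); anything Ext-side.  New names only.
-/

open Module

namespace Summit.Ventures.HSemireg.Wedge.HankelFrameChange

open Summit.Ventures.HSemireg.Wedge Summit.Ventures.HSemireg.Wedge.Kunneth Summit.Ventures.HSemireg.Wedge.Hankel
  Summit.Ventures.HSemireg.Wedge.BasisFree Summit.Ventures.HSemireg.Wedge.HankelSiegel Summit.Ventures.HSemireg.Wedge.HankelSiegelIdeal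
  Summit.Ventures.HSemireg.Wedge.KunnethKernel Summit.Ventures.HSemireg.Wedge.HankelRankOne Summit.Ventures.HSemireg.Wedge.KernelDuality

variable (K : Type*) [Field K] {n : ℕ}

/-! ## §250. The swap on `E_0` and the lower Jordan chain -/

/-- the swap sends the pure class to the point class: `Sb 0 1 1 0 (E_0) = E_n` (J1 `Sb_w_spike_zero` at `(α β γ δ) = (0 1 1 0)`). -/
theorem Sb_swap_w_spike_zero : Sb K 0 1 1 0 (w K n n (fun j => if j = 0 then (1 : K) else 0)) = w K n n (fun j => if j = n then (1 : K) else 0) := by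
  rw [Sb_w_spike_zero]
  refine (w_eq_w_iff K _ _).2 fun j hj => ?_
  rw [one_pow, mul_one]
  by_cases h : j = n
  · rw [h, if_pos rfl, Nat.sub_self, pow_zero]
  · rw [if_neg h, zero_pow (by omega)]

/-- class-space form: `SbC(0 1 1 0) E_0 = E_n`. -/
theorem SbC_swap_spike_zero :
    SbC K 0 1 1 0 (⟨w K n n (fun j => if j = 0 then (1 : K) else 0), w_mem_spikeSpan K _⟩ : spikeSpan K n) = ⟨w K n n (fun j => if j = n then (1 : K) else 0), w_mem_spikeSpan K _⟩ :=
  Subtype.ext (by rw [SbC_apply_coe, Sb_swap_w_spike_zero])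

/-- `(SbC(1 0 1 1) − 1)·S = S·(SbC(1 1 0 1) − 1)` with `S = SbC(0 1 1 0)` (J11: the lower shear is the swap-conjugate of the upper shear, `S·S = 1`). -/
theorem SbC_lower_shear_sub_one_mul_swap : (SbC K 1 0 1 1 (n := n) - 1) * SbC K 0 1 1 0 = SbC K 0 1 1 0 * (SbC K 1 1 0 1 - 1) := by
  refine LinearMap.ext fun f => ?_
  have hSS : SbC K 0 1 1 0 (SbC K 0 1 1 0 f) = f := by rw [← Module.End.mul_apply, SbC_swap_mul_swap, Module.End.one_apply]
  have hL : SbC K 1 0 1 1 (SbC K 0 1 1 0 f) = SbC K 0 1 1 0 (SbC K 1 1 0 1 f) := by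
    rw [SbC_lower_shear_eq_swap_conj, Module.End.mul_apply, Module.End.mul_apply, hSS]
  simp only [Module.End.mul_apply, LinearMap.sub_apply, Module.End.one_apply, map_sub, hL]

/-- **THE LOWER JORDAN CHAIN ENDS IN THE PURE CLASS: `(SbC(1 0 1 1) − 1)^n E_n = n!·E_0`** (conjugate I18's upper chain `(SbC(1 1 0 1) − 1)^n E_0 = n!·E_n` by the swap). -/
theorem SbC_lower_shear_sub_one_pow_self_apply_spike_top :
    ((SbC K 1 0 1 1 - 1) ^ n) (⟨w K n n (fun j => if j = n then (1 : K) else 0), w_mem_spikeSpan K _⟩ : spikeSpan K n) =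
      (n.factorial : K) • ⟨w K n n (fun j => if j = 0 then (1 : K) else 0), w_mem_spikeSpan K _⟩ := by
  rw [pow_eq_conj_of_mul_eq K (SbC_lower_shear_sub_one_mul_swap K) (SbC_swap_mul_swap K) n, Module.End.mul_apply, Module.End.mul_apply, SbC_swap_spike_top,
    SbC_shear_sub_one_pow_self_apply_spike_zero, one_pow, mul_one, map_smul, SbC_swap_spike_top]

/-! ## §251. Stable under both shears ⇒ everything -/

/-- **for `n! ≠ 0`: a non-zero subspace of the class space stable under the upper shear `SbC(1 1 0 1)` AND the lower shear `SbC(1 0 1 1)` contains the pure class `E_0`** (J9 gives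
`E_n`; the lower chain gives `n!·E_0`). -/
theorem spike_zero_mem_of_unipotent_stable (hfac : (n.factorial : K) ≠ 0) {W : Submodule K (spikeSpan K n)} (hU : ∀ f ∈ W, SbC K 1 1 0 1 f ∈ W)
    (hL : ∀ f ∈ W, SbC K 1 0 1 1 f ∈ W) (hW : W ≠ ⊥) :
    (⟨w K n n (fun j => if j = 0 then (1 : K) else 0), w_mem_spikeSpan K _⟩ : spikeSpan K n) ∈ W := by
  have hN : ∀ f ∈ W, (SbC K 1 0 1 1 - 1) f ∈ W := fun f hf => by
    rw [LinearMap.sub_apply, Module.End.one_apply]; exact Submodule.sub_mem _ (hL f hf) hf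
  have h := pow_apply_mem_of_forall_mem K hN (spike_top_mem_of_stable K hfac hU hW) n
  rw [SbC_lower_shear_sub_one_pow_self_apply_spike_top] at h
  exact (Submodule.smul_mem_iff _ hfac).mp h

/-- a shear-stable subspace containing `E_0` is everything (`n! ≠ 0`; J9 `spike_mem_of_stable` for every spike + th-7's spike basis). -/
theorem eq_top_of_shear_stable_of_spike_zero_mem (hfac : (n.factorial : K) ≠ 0) {W : Submodule K (spikeSpan K n)} (hU : ∀ f ∈ W, SbC K 1 1 0 1 f ∈ W)
    (h0 : (⟨w K n n (fun j => if j = 0 then (1 : K) else 0), w_mem_spikeSpan K _⟩ : spikeSpan K n) ∈ W) : W = ⊤ := by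
  rw [eq_top_iff]
  intro f _
  rw [← (spikeBasis K n).sum_repr f]
  refine Submodule.sum_mem _ fun p _ => Submodule.smul_mem _ _ ?_
  have e : spikeBasis K n p = ⟨w K n n (fun j => if j = (p : ℕ) then (1 : K) else 0), w_mem_spikeSpan K _⟩ := Subtype.ext (spikeBasis_coe K p)
  rw [e]
  exact spike_mem_of_stable K hfac hU h0 (by have := p.2; omega)

/-- **TH-7's CLASS SPACE IS IRREDUCIBLE UNDER THE TWO SHEARS WHEN `n! ≠ 0`: every non-zero subspace of `spikeSpan n` stable under `SbC(1 1 0 1)` and `SbC(1 0 1 1)` is `⊤`.** -/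
theorem eq_top_of_unipotent_stable (hfac : (n.factorial : K) ≠ 0) {W : Submodule K (spikeSpan K n)} (hU : ∀ f ∈ W, SbC K 1 1 0 1 f ∈ W)
    (hL : ∀ f ∈ W, SbC K 1 0 1 1 f ∈ W) (hW : W ≠ ⊥) : W = ⊤ :=
  eq_top_of_shear_stable_of_spike_zero_mem K hfac hU (spike_zero_mem_of_unipotent_stable K hfac hU hL hW)

/-- dichotomy form. -/
theorem eq_bot_or_eq_top_of_unipotent_stable (hfac : (n.factorial : K) ≠ 0) {W : Submodule K (spikeSpan K n)} (hU : ∀ f ∈ W, SbC K 1 1 0 1 f ∈ W)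
    (hL : ∀ f ∈ W, SbC K 1 0 1 1 f ∈ W) : W = ⊥ ∨ W = ⊤ := by
  by_cases hW : W = ⊥
  · exact Or.inl hW
  · exact Or.inr (eq_top_of_unipotent_stable K hfac hU hL hW)

/-! ## §252. The full monoid of substitutions -/

/-- **a subspace of th-7's class space stable under EVERY substitution `SbC(g)` is `⊥` or `⊤`** when `n! ≠ 0` in `K` (already the two shears suffice). -/
theorem eq_bot_or_eq_top_of_forall_SbC_stable (hfac : (n.factorial : K) ≠ 0) {W : Submodule K (spikeSpan K n)}
    (h : ∀ α β γ δ : K, ∀ f ∈ W, SbC K α β γ δ f ∈ W) : W = ⊥ ∨ W = ⊤ :=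
  eq_bot_or_eq_top_of_unipotent_stable K hfac (h 1 1 0 1) (h 1 0 1 1)

/-- characteristic `0`: the same for every `n`. -/
theorem eq_bot_or_eq_top_of_forall_SbC_stable_charZero [CharZero K] {W : Submodule K (spikeSpan K n)}
    (h : ∀ α β γ δ : K, ∀ f ∈ W, SbC K α β γ δ f ∈ W) : W = ⊥ ∨ W = ⊤ :=
  eq_bot_or_eq_top_of_forall_SbC_stable K (Nat.cast_ne_zero.2 (Nat.factorial_ne_zero n)) h

end Summit.Ventures.HSemireg.Wedge.HankelFrameChange
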